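import Literature.RepresentationTheory.Semisimple.UnitaryLocallyFinite
import Literature.NumberTheory.Automorphic.SmoothRepresentation
import Mathlib.Topology.Algebra.OpenSubgroup
import HarnessLib

/-!
# Admissible unitary representations of totally disconnected groups are completely reducible

Topic `RepresentationTheory/Unitary`; namespace `Literature.RepresentationTheory.Unitary`.  KERNEL ONLY: theorems,
0 definitions, 0 records, 0 named facts, 0 `sorry`.

Let `G` be a topological group possessing a COMPACT OPEN subgroup `K` (e.g. any locally profinite group: a reductive
group over a non-archimedean local field, the local unitary groups `U(V)(F_v)` of the tree), and let
`ρ : Representation ℂ G V` act on a complex inner product space `V` (no completeness) by UNITARY operators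
(`⟪ρ g v, ρ g w⟫ = ⟪v, w⟫`, hypothesis `hU`).  If `ρ` is ADMISSIBLE in the sense of the tree's
`Representation.IsAdmissible` (`Literature/NumberTheory/Automorphic/SmoothRepresentation.lean`: smooth, and `V^{K'}` finite
dimensional for every compact open `K'`), then:

* `finite_range_restrict_of_isSmooth` / `finiteDimensional_span_range_restrict` (§1) — the restriction `ρ|_K = ρ ∘ K.subtype` is
  LOCALLY FINITE: every `K`-orbit is finite (an open stabiliser has finite index in the compact `K`), so its span is
  finite dimensional;
* `toSubspace_le_fixedPoints_of_linearEquiv` / `finiteDimensional_isotypicComponent_restrict` (§2) — every isotypic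
  component of the `ℂ[K]`-module `ρ|_K` (Mathlib `isotypicComponents`) is finite dimensional: a simple constituent `S`
  is finite dimensional, hence fixed by a compact open `K' ≤ K`, hence so is every submodule isomorphic to `S`, and
  `V^{K'}` is finite dimensional by admissibility («each `K`-type occurs with finite multiplicity»);
* **`sup_orthogonal_eq_top_of_isAdmissible`** (§3) — for every `G`-invariant subspace `U`, `U ⊔ Uᗮ = ⊤`; with
  `orthogonal_invariant` (tree, `Semisimple/UnitaryLocallyFinite`) `Uᗮ` is a `G`-invariant complement
  (`isCompl_orthogonal_of_isAdmissible`), so **`isSemisimpleRepresentation_of_isAdmissible`**: `ρ` is a semisimple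
  representation (Mathlib `Representation.IsSemisimpleRepresentation`, the lattice of subrepresentations is
  complemented; equivalently `IsSemisimpleModule ℂ[G] ρ.asModule`, `isSemisimpleModule_asModule_of_isAdmissible`), i.e.
  `V` is a direct sum of irreducible subrepresentations, each occurring `K`-type by `K`-type with finite multiplicity.

The proof is the classical one ([Bump1997, Prop. 4.2.5 proof; Cartier1979, §1.5]; for `(𝔤, K)`-modules [KnappVogan1995,
Ch. IX §1 p. 597] «the admissibility forces `P_τ V = P_τ W ⊕ P_τ W^⊥`, and then `V = W ⊕ W^⊥`»): §3 is the tree's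
`Semisimple.sup_orthogonal_eq_top_of_invariant` applied to the compact open `K`, whose two hypotheses (local finiteness,
finite-dimensional isotypic components) are exactly §1 and §2.  No Haar measure and no topology on `V` beyond the inner
product are used.

Written for the cell `hodgecm-mathlib` (fan B, rung B-IV, KEY `b4-howe-compact-irreducible`): it is node D3 of the proof
of `MoeglinVignerasWaldspurger1987.mvw_IV4_rankOne_irreducibleOrZero` — the theta lift `Θ(χ)` of a character of the
compact `U(1)` to `U(V)(F_v)` is unitary (it sits in `𝒮(F_vᴺ) ⊂ L²`) and admissible ([MVW87, Chap. 3 IV.4 2a)]), hence a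
direct sum of irreducibles, on which the doubling see-saw and Kudla's Jacquet-module computation then act summand by
summand.  Nothing about theta lifts is asserted here.

## References
* [Bump1997] D. Bump, *Automorphic forms and representations*, CUP 1997, Prop. 4.2.5 and proof of Prop. 4.8.1.
* [Cartier1979] P. Cartier, *Representations of p-adic groups: a survey*, PSPM 33.1 (1979) 111–155, §1.5.
* [KnappVogan1995] A. Knapp, D. Vogan, *Cohomological induction and unitary representations*, PUP 1995, Ch. IX §1.
* [BernsteinZelevinsky1976] I. N. Bernstein, A. V. Zelevinsky, Russian Math. Surveys 31 (1976), §2.1 (admissible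
  representations; unitarisable admissible representations are completely reducible).
-/

set_option autoImplicit false

noncomputable section

open scoped InnerProductSpace

namespace Literature.RepresentationTheory.Unitary

open Literature.RepresentationTheory.Semisimple

/-! ## §1 The restriction to a compact open subgroup is locally finite -/

section LocallyFinite

variable {G : Type*} [Group G] [TopologicalSpace G] [IsTopologicalGroup G]
  {V : Type*} [AddCommGroup V] [Module ℂ V] (ρ : Representation ℂ G V)

/-- **A smooth vector has a FINITE orbit under a compact open subgroup**: its stabiliser is open, so meets the compact
`K` in an open subgroup of finite index. [cite: BernsteinZelevinsky1976, §2.1] -/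
theorem finite_range_restrict_of_isSmooth (K : OpenSubgroup G) (hK : IsCompact (K : Set G)) (hρ : ρ.IsSmooth)
    (v : V) : (Set.range fun k : (K : Subgroup G) => ρ (k : G) v).Finite := by
  haveI : CompactSpace (K : Subgroup G) := isCompact_iff_compactSpace.mp hK
  -- the stabiliser of `v` inside `K`, an open subgroup of the compact group `K`
  set S : Subgroup (K : Subgroup G) := (ρ.stabilizerSubgroup v).comap (K : Subgroup G).subtype with hS
  have hSo : IsOpen (S : Set (K : Subgroup G)) := (hρ v).preimage continuous_subtype_val
  haveI : Finite ((K : Subgroup G) ⧸ S) := Subgroup.quotient_finite_of_isOpen S hSo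
  refine (Set.finite_range fun q : (K : Subgroup G) ⧸ S => ρ ((q.out : (K : Subgroup G)) : G) v).subset ?_
  rintro _ ⟨k, rfl⟩
  refine ⟨(k : (K : Subgroup G) ⧸ S), ?_⟩
  -- `(k : K/S).out = k * s` with `s ∈ S` fixing `v`
  have hmem : k⁻¹ * Quotient.out (k : (K : Subgroup G) ⧸ S) ∈ S := by
    rw [← QuotientGroup.eq, QuotientGroup.out_eq']
  have hfix : ρ (((k⁻¹ * Quotient.out (k : (K : Subgroup G) ⧸ S) : (K : Subgroup G))) : G) v = v :=
    (ρ.mem_stabilizerSubgroup v _).1 (Subgroup.mem_comap.1 hmem)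
  have hk : ((Quotient.out (k : (K : Subgroup G) ⧸ S) : (K : Subgroup G)) : G)
      = (k : G) * (((k⁻¹ * Quotient.out (k : (K : Subgroup G) ⧸ S) : (K : Subgroup G))) : G) := by
    simp only [Subgroup.coe_mul, Subgroup.coe_inv, mul_inv_cancel_left]
  show ρ ((Quotient.out (k : (K : Subgroup G) ⧸ S) : (K : Subgroup G)) : G) v = ρ (k : G) v
  rw [hk, map_mul, Module.End.mul_apply, hfix]

/-- hence **`ρ|_K` is locally finite**: the span of every `K`-orbit is finite dimensional. [cite: BernsteinZelevinsky1976, §2.1] -/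
theorem finiteDimensional_span_range_restrict (K : OpenSubgroup G) (hK : IsCompact (K : Set G)) (hρ : ρ.IsSmooth)
    (v : V) : FiniteDimensional ℂ (Submodule.span ℂ (Set.range fun k : (K : Subgroup G) => (ρ.comp (K : Subgroup G).subtype : Representation ℂ (K : Subgroup G) V) k v)) :=
  FiniteDimensional.span_of_finite ℂ (finite_range_restrict_of_isSmooth ρ K hK hρ v)

end LocallyFinite

/-! ## §2 Admissibility: the isotypic components of `ρ|_K` are finite dimensional -/

section Isotypic

variable {G : Type*} [Group G] [TopologicalSpace G] [IsTopologicalGroup G]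
  {V : Type*} [NormedAddCommGroup V] [InnerProductSpace ℂ V] (ρ : Representation ℂ G V)

omit [TopologicalSpace G] [IsTopologicalGroup G] in
/-- If a `ℂ[K]`-submodule `S` of `ρ|_K` is pointwise fixed by a subgroup `K' ≤ K` of `G`, then so is every submodule
`m` ISOMORPHIC to `S` (a `ℂ[K]`-linear isomorphism commutes with the action of `K' ⊆ K`). [cite: BernsteinZelevinsky1976, §2.1] -/
theorem toSubspace_le_fixedPoints_of_linearEquiv (K : Subgroup G) {K' : Subgroup G} (hK' : K' ≤ K)
    {S m : Submodule (MonoidAlgebra ℂ K) (Representation.asModule (ρ.comp K.subtype : Representation ℂ K V))} (e : m ≃ₗ[MonoidAlgebra ℂ K] S)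
    (hS : toSubspace ((ρ.comp K.subtype : Representation ℂ K V)) S ≤ ρ.fixedPoints K') : toSubspace ((ρ.comp K.subtype : Representation ℂ K V)) m ≤ ρ.fixedPoints K' := by
  intro v hv
  rw [Representation.mem_fixedPoints]
  intro g hg
  -- `x = v` read in `m`, `y = e x ∈ S`
  set x : m := ⟨(Representation.asModuleEquiv (ρ.comp K.subtype : Representation ℂ K V)).symm v, mem_toSubspace_iff.mp hv⟩ with hx
  set kk : K := ⟨g, hK' hg⟩ with hkk
  have hy : (Representation.asModuleEquiv (ρ.comp K.subtype : Representation ℂ K V)) ((e x : S) : (Representation.asModule (ρ.comp K.subtype : Representation ℂ K V))) ∈ toSubspace ((ρ.comp K.subtype : Representation ℂ K V)) S :=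
    asModuleEquiv_mem_toSubspace_iff.mpr (e x).2
  have hyfix : ρ g ((Representation.asModuleEquiv (ρ.comp K.subtype : Representation ℂ K V)) ((e x : S) : (Representation.asModule (ρ.comp K.subtype : Representation ℂ K V))))
      = (Representation.asModuleEquiv (ρ.comp K.subtype : Representation ℂ K V)) ((e x : S) : (Representation.asModule (ρ.comp K.subtype : Representation ℂ K V))) :=
    (Representation.mem_fixedPoints ρ K' _).1 (hS hy) g hg
  -- `single kk 1 • y = y` in `S`
  have h1 : MonoidAlgebra.single kk (1 : ℂ) • (e x) = e x := by
    apply Subtype.ext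
    rw [Submodule.coe_smul, Representation.single_smul, one_smul, MonoidHom.comp_apply, Subgroup.subtype_apply]
    -- both sides are elements of the type synonym `asModule = V`
    change ρ g ((Representation.asModuleEquiv (ρ.comp K.subtype : Representation ℂ K V)) _) = (Representation.asModuleEquiv (ρ.comp K.subtype : Representation ℂ K V)) _
    exact hyfix
  -- transport through `e`: `single kk 1 • x = x` in `m`
  have h2 : MonoidAlgebra.single kk (1 : ℂ) • x = x := by
    apply e.injective
    rw [map_smul, h1]
  have h3 := congrArg (fun z : m => (Representation.asModuleEquiv (ρ.comp K.subtype : Representation ℂ K V)) (z : (Representation.asModule (ρ.comp K.subtype : Representation ℂ K V)))) h2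
  simp only [Submodule.coe_smul, Representation.asModuleEquiv_map_smul, Representation.asAlgebraHom_single, one_smul,
    hx, LinearEquiv.apply_symm_apply, MonoidHom.comp_apply, Subgroup.subtype_apply] at h3
  exact h3

/-- **Admissible ⇒ every isotypic component of `ρ|_K` is finite dimensional** (`K` compact open): a simple
`ℂ[K]`-submodule `S` is finite dimensional (local finiteness, §1), so a finite basis of it is fixed by a compact open
`K' ≤ K`; every submodule isomorphic to `S` is then fixed by `K'` (previous lemma), so the isotypic component
`Σ_{m ≅ S} m` lies in `V^{K'}`, finite dimensional by admissibility. [cite: BernsteinZelevinsky1976, §2.1] -/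
theorem finiteDimensional_isotypicComponent_restrict (K : OpenSubgroup G) (hK : IsCompact (K : Set G))
    (hadm : ρ.IsAdmissible) {c : Submodule (MonoidAlgebra ℂ (K : Subgroup G)) (Representation.asModule (ρ.comp (K : Subgroup G).subtype : Representation ℂ (K : Subgroup G) V))}
    (hc : c ∈ isotypicComponents (MonoidAlgebra ℂ (K : Subgroup G)) (Representation.asModule (ρ.comp (K : Subgroup G).subtype : Representation ℂ (K : Subgroup G) V))) :
    FiniteDimensional ℂ (toSubspace ((ρ.comp (K : Subgroup G).subtype : Representation ℂ (K : Subgroup G) V)) c) := by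
  obtain ⟨S, hSimple, rfl⟩ := hc
  haveI := hSimple
  -- `S` is finite dimensional
  haveI hSfd : FiniteDimensional ℂ (toSubspace ((ρ.comp (K : Subgroup G).subtype : Representation ℂ (K : Subgroup G) V)) S) :=
    finiteDimensional_toSubspace_of_isSimpleModule (finiteDimensional_span_range_restrict ρ K hK hadm.isSmooth) S
  -- a compact open `K' ≤ K` fixing `S`: `K ⊓ ⋂_i Stab(b i)` for a finite basis `b`
  let b := Module.finBasis ℂ (toSubspace ((ρ.comp (K : Subgroup G).subtype : Representation ℂ (K : Subgroup G) V)) S)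
  set K'sg : Subgroup G :=
    (K : Subgroup G) ⊓ ⨅ i, ρ.stabilizerSubgroup ((b i : toSubspace ((ρ.comp (K : Subgroup G).subtype : Representation ℂ (K : Subgroup G) V)) S) : V) with hK'sg
  have hK'open : IsOpen (K'sg : Set G) := by
    have hset : (K'sg : Set G) =
        (K : Set G) ∩ ⋂ i, (ρ.stabilizerSubgroup ((b i : toSubspace ((ρ.comp (K : Subgroup G).subtype : Representation ℂ (K : Subgroup G) V)) S) : V) : Set G) := by
      rw [hK'sg, Subgroup.coe_inf, Subgroup.coe_iInf]
      rfl
    rw [hset]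
    exact K.isOpen.inter (isOpen_iInter_of_finite fun i => hadm.isSmooth _)
  let K' : OpenSubgroup G := ⟨K'sg, hK'open⟩
  have hK'le : (K' : Subgroup G) ≤ (K : Subgroup G) := inf_le_left
  have hK'cpt : IsCompact (K' : Set G) :=
    hK.of_isClosed_subset (OpenSubgroup.isClosed K') (fun x hx => hK'le hx)
  haveI : Module.Finite ℂ (ρ.fixedPoints (K' : Subgroup G)) := hadm.finite_fixedPoints K' hK'cpt
  -- `S ≤ V^{K'}`
  have hSfix : toSubspace ((ρ.comp (K : Subgroup G).subtype : Representation ℂ (K : Subgroup G) V)) S ≤ ρ.fixedPoints (K' : Subgroup G) := by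
    intro v hv
    rw [Representation.mem_fixedPoints]
    intro g hg
    have hg' : ∀ i, g ∈ ρ.stabilizerSubgroup ((b i : toSubspace ((ρ.comp (K : Subgroup G).subtype : Representation ℂ (K : Subgroup G) V)) S) : V) := fun i =>
      Subgroup.mem_iInf.1 (Subgroup.mem_inf.1 hg).2 i
    -- `v = Σ cᵢ bᵢ`
    have hv' : v = ∑ i, b.repr ⟨v, hv⟩ i • ((b i : toSubspace ((ρ.comp (K : Subgroup G).subtype : Representation ℂ (K : Subgroup G) V)) S) : V) := by
      have h := congrArg (fun w : toSubspace ((ρ.comp (K : Subgroup G).subtype : Representation ℂ (K : Subgroup G) V)) S => (w : V)) (b.sum_repr ⟨v, hv⟩)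
      simpa only [Submodule.coe_sum, Submodule.coe_smul] using h.symm
    rw [hv', map_sum]
    refine Finset.sum_congr rfl fun i _ => ?_
    rw [map_smul, (ρ.mem_stabilizerSubgroup _ g).1 (hg' i)]
  -- every `m ≅ S` is fixed by `K'`, hence the isotypic component is
  have hle : toSubspace ((ρ.comp (K : Subgroup G).subtype : Representation ℂ (K : Subgroup G) V))
      (isotypicComponent (MonoidAlgebra ℂ (K : Subgroup G)) (Representation.asModule (ρ.comp (K : Subgroup G).subtype : Representation ℂ (K : Subgroup G) V)) S)
      ≤ ρ.fixedPoints (K' : Subgroup G) := by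
    rw [isotypicComponent, sSup_eq_iSup', toSubspace_iSup]
    refine iSup_le fun m => ?_
    obtain ⟨e⟩ := m.2
    exact toSubspace_le_fixedPoints_of_linearEquiv ρ (K : Subgroup G) hK'le e hSfix
  exact Submodule.finiteDimensional_of_le hle

end Isotypic

/-! ## §3 Complete reducibility -/

section Semisimple

variable {G : Type*} [Group G] [TopologicalSpace G] [IsTopologicalGroup G]
  {V : Type*} [NormedAddCommGroup V] [InnerProductSpace ℂ V] {ρ : Representation ℂ G V}

/-- **`U ⊔ Uᗮ = ⊤` for every invariant subspace `U` of an admissible unitary representation** of a group with a compact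
open subgroup `K` (apply the tree's `sup_orthogonal_eq_top_of_invariant` to the locally finite unitary `ρ|_K`, whose
isotypic components are finite dimensional by §2; `U` is `K`-invariant). [cite: Bump1997, Prop. 4.2.5] -/
theorem sup_orthogonal_eq_top_of_isAdmissible (K : OpenSubgroup G) (hK : IsCompact (K : Set G))
    (hU : ∀ g v w, ⟪ρ g v, ρ g w⟫_ℂ = ⟪v, w⟫_ℂ) (hadm : ρ.IsAdmissible)
    {U : Submodule ℂ V} (hUinv : ∀ g, ∀ v ∈ U, ρ g v ∈ U) : U ⊔ Uᗮ = ⊤ :=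
  sup_orthogonal_eq_top_of_invariant (ρ := (ρ.comp (K : Subgroup G).subtype : Representation ℂ (K : Subgroup G) V)) (fun k v w => hU (k : G) v w)
    (finiteDimensional_span_range_restrict ρ K hK hadm.isSmooth)
    (fun _ hc => finiteDimensional_isotypicComponent_restrict ρ K hK hadm hc) fun k v hv => hUinv (k : G) v hv

/-- **The orthogonal complement of an invariant subspace is an invariant complement** (admissible unitary `ρ`,
compact open `K ≤ G`). [cite: Bump1997, Prop. 4.2.5] -/
theorem isCompl_orthogonal_of_isAdmissible (K : OpenSubgroup G) (hK : IsCompact (K : Set G))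
    (hU : ∀ g v w, ⟪ρ g v, ρ g w⟫_ℂ = ⟪v, w⟫_ℂ) (hadm : ρ.IsAdmissible)
    {U : Submodule ℂ V} (hUinv : ∀ g, ∀ v ∈ U, ρ g v ∈ U) :
    IsCompl U Uᗮ ∧ ∀ g, ∀ v ∈ Uᗮ, ρ g v ∈ Uᗮ :=
  ⟨⟨(Submodule.isOrtho_orthogonal_right U).disjoint,
      codisjoint_iff.2 (sup_orthogonal_eq_top_of_isAdmissible K hK hU hadm hUinv)⟩,
    fun g _ hv => orthogonal_invariant hU hUinv g hv⟩

/-- **An admissible unitary representation of a group with a compact open subgroup is completely reducible**: the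
lattice of subrepresentations is complemented (Mathlib `Representation.IsSemisimpleRepresentation`), the complement of
`W` being `Wᗮ`. [cite: Bump1997, Prop. 4.2.5] -/
theorem isSemisimpleRepresentation_of_isAdmissible (K : OpenSubgroup G) (hK : IsCompact (K : Set G))
    (hU : ∀ g v w, ⟪ρ g v, ρ g w⟫_ℂ = ⟪v, w⟫_ℂ) (hadm : ρ.IsAdmissible) : ρ.IsSemisimpleRepresentation := by
  refine ⟨fun W => ?_⟩
  obtain ⟨hc, hinv⟩ := isCompl_orthogonal_of_isAdmissible K hK hU hadm W.apply_mem_toSubmodule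
  refine ⟨⟨W.toSubmoduleᗮ, fun g v hv => hinv g v hv⟩, ?_, ?_⟩
  · -- disjoint
    rw [disjoint_iff]
    apply Subrepresentation.toSubmodule_injective
    exact disjoint_iff.1 hc.1
  · -- codisjoint
    rw [codisjoint_iff]
    apply Subrepresentation.toSubmodule_injective
    exact codisjoint_iff.1 hc.2

/-- … equivalently `V` is a semisimple `ℂ[G]`-module (a direct sum of simple submodules, Mathlib
`IsSemisimpleModule.sSup_simples_eq_top` / `isSemisimpleModule_iff_exists_linearEquiv_dfinsupp`). [cite: Bump1997, Prop. 4.2.5] -/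
theorem isSemisimpleModule_asModule_of_isAdmissible (K : OpenSubgroup G) (hK : IsCompact (K : Set G))
    (hU : ∀ g v w, ⟪ρ g v, ρ g w⟫_ℂ = ⟪v, w⟫_ℂ) (hadm : ρ.IsAdmissible) :
    IsSemisimpleModule (MonoidAlgebra ℂ G) ρ.asModule :=
  (Representation.isSemisimpleRepresentation_iff_isSemisimpleModule_asModule ρ).mp
    (isSemisimpleRepresentation_of_isAdmissible K hK hU hadm)

end Semisimple

end Literature.RepresentationTheory.Unitary

end
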